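import Mathlib
import Summits.Ventures.PercRepro2.SwGlueBlocks
import Summits.Ventures.PercRepro2.SwAllGlueAll
import Summits.Ventures.PercRepro2.SwAllBlocksAll
import Summits.Ventures.PercRepro2.SwSeries
import Summits.Ventures.PercRepro2.SwParallel

/-!
# The residual class of row 2′SW-ALL: the assembled reduction (blind cell PercRepro2, night-4 g6,
2026-08-24; proofs/NIGHT4-G6.md §9)

One strong induction on the number of edges assembles the block reduction (`Glue.swAll_glue_of_sides`
at a cut vertex), the series reduction (`Series.swAll_series` at a non-mark vertex of degree two) and
the parallel reduction (`Parallel.swAll_parallel` at a pair of parallel edges) of the rigid row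
2′SW-ALL (`LocRows.SwAll`).  `SwAllResidual` is the rigid row on the multigraphs WITHOUT a cut
vertex, WITHOUT parallel edges and WITHOUT a non-mark vertex of degree two; `swAll_all_of_residual`:
it gives the rigid row on every finite multigraph (`LocRows.SwAll_all`), hence row (SW), 2′DOM and
(BASE) (`sw_all_of_residual`).  The reductions at a two-vertex cut (the `{l, h}`-bridge lemma
`Glue2.swAll_glue2`, the one-sided ear composition `Ear.swAll_ear`) are theorems for a given
gluing and are not folded in here: the residual of record is `SwAllResidual`, the 2-cut reductions
sharpen it on paper (NIGHT4-BRIDGE.md §9–§10).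
-/

namespace Summit.Ventures.PercRepro2

namespace Glue

open Hull LocRows

open scoped Classical

variable {V : Type*}

/-! ## Degenerate placements: `Q` is empty unless the marks are distinct -/

section Degenerate

variable {E : Type*} [Fintype E] [DecidableEq E] {ends : E → Sym2 V}

/-- If two of the marks coincide, `Q` is empty and the rigid row holds vacuously. -/
theorem swAll_of_not_distinct {l h o : V} (hne : ¬ (l ≠ h ∧ o ≠ l ∧ o ≠ h)) :
    SwAll ends l h o := by
  apply swAll_of_empty
  rw [Finset.eq_empty_iff_forall_notMem]
  intro ζ hζ
  simp only [tgtU, Finset.mem_filter, Finset.mem_univ, true_and, mem_hull_iff, Set.mem_setOf_eq,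
    not_or] at hζ
  obtain ⟨⟨hA, hB⟩, hoA, hoB⟩ := hζ
  apply hne
  refine ⟨fun hlh => hA (hlh ▸ mem_cluster_self _ _ _), fun hol => hoB (hol ▸ mem_cluster_self _ _ _),
    fun hoh => hA (hoh ▸ hoA)⟩

/-- The rigid row for every placement of the marks, distinct or not, from the distinct case. -/
theorem swAll_all_marks (hs : ∀ l h o : V, l ≠ h → o ≠ l → o ≠ h → SwAll ends l h o) (l h o : V) :
    SwAll ends l h o := by
  by_cases hne : l ≠ h ∧ o ≠ l ∧ o ≠ h
  · exact hs l h o hne.1 hne.2.1 hne.2.2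
  · exact swAll_of_not_distinct hne

end Degenerate

/-! ## The residual class -/

section Residual

variable {E : Type*} (ends : E → Sym2 V)

/-- A non-mark vertex of degree two. -/
def HasDeg2 (l h o : V) : Prop :=
  ∃ (w u v : V) (e₁ e₂ : E), Series.IsDeg2 ends w u v e₁ e₂ ∧ w ≠ l ∧ w ≠ h ∧ w ≠ o

/-- A pair of parallel edges. -/
def HasParallel : Prop := ∃ (u v : V) (e e' : E), Parallel.IsParallel ends u v e e'

end Residual

/-- **The residual class of row 2′SW-ALL**: the rigid row on the multigraphs without a cut vertex,
without parallel edges and without a non-mark vertex of degree two. -/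
def SwAllResidual : Prop :=
  ∀ (V E : Type) [Fintype V] [DecidableEq V] [Fintype E] [DecidableEq E] (ends : E → Sym2 V),
    (¬ ∃ (c : V) (V₁ V₂ : Set V), HasCut ends c V₁ V₂) → ¬ HasParallel ends →
      ∀ l h o : V, l ≠ h → o ≠ l → o ≠ h → ¬ HasDeg2 ends l h o → SwAll ends l h o

/-! ## Counting the edges of the reduced graphs -/

section Cards

variable {E : Type*} [Fintype E] [DecidableEq E]

/-- `G − e'` has fewer edges. -/
lemma card_delE_lt (e' : E) : Fintype.card (Parallel.DelE e') < Fintype.card E :=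
  Fintype.card_subtype_lt (x := e') (by simp)

/-- `G − {e, e'}` has at least two edges fewer. -/
lemma card_mergeE_add_two_le {e e' : E} (hne : e ≠ e') :
    Fintype.card (Parallel.MergeE e e') + 2 ≤ Fintype.card E := by
  have h1 : Fintype.card (Parallel.MergeE e e') =
      (Finset.univ.filter fun x : E => x ≠ e ∧ x ≠ e').card := Fintype.card_subtype _
  have h2 : (Finset.univ.filter fun x : E => x ≠ e ∧ x ≠ e').card +
      (Finset.univ.filter fun x : E => ¬ (x ≠ e ∧ x ≠ e')).card = Fintype.card E := by
    rw [Finset.card_filter_add_card_filter_not, Finset.card_univ]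
  have h3 : (Finset.univ.filter fun x : E => ¬ (x ≠ e ∧ x ≠ e')) = {e, e'} := by
    ext x; simp only [Finset.mem_filter, Finset.mem_univ, true_and, Finset.mem_insert,
      Finset.mem_singleton, not_and_or, not_not]
  rw [h3, Finset.card_pair hne] at h2
  omega

/-- `G − w` has at least two edges fewer. -/
lemma card_seriesDelE_add_two_le {e₁ e₂ : E} (hne : e₁ ≠ e₂) :
    Fintype.card (Series.DelE e₁ e₂) + 2 ≤ Fintype.card E := by
  have h1 : Fintype.card (Series.DelE e₁ e₂) =
      (Finset.univ.filter fun x : E => x ≠ e₁ ∧ x ≠ e₂).card := Fintype.card_subtype _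
  have h2 : (Finset.univ.filter fun x : E => x ≠ e₁ ∧ x ≠ e₂).card +
      (Finset.univ.filter fun x : E => ¬ (x ≠ e₁ ∧ x ≠ e₂)).card = Fintype.card E := by
    rw [Finset.card_filter_add_card_filter_not, Finset.card_univ]
  have h3 : (Finset.univ.filter fun x : E => ¬ (x ≠ e₁ ∧ x ≠ e₂)) = {e₁, e₂} := by
    ext x; simp only [Finset.mem_filter, Finset.mem_univ, true_and, Finset.mem_insert,
      Finset.mem_singleton, not_and_or, not_not]
  rw [h3, Finset.card_pair hne] at h2
  omega

end Cards

/-! ## The assembled reduction -/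

/-- **The reduction of row 2′SW-ALL to its residual class**: the rigid row on the multigraphs without
a cut vertex, without parallel edges and without a non-mark vertex of degree two gives the rigid row
on every finite multigraph — strong induction on the number of edges through the block, parallel and
series reductions. -/
theorem swAll_all_of_residual (hres : SwAllResidual) : SwAll_all := by
  suffices key : ∀ n : ℕ, ∀ (V E : Type) [Fintype V] [DecidableEq V] [Fintype E] [DecidableEq E]
      (ends : E → Sym2 V), Fintype.card E = n →
        ∀ l h o : V, l ≠ h → o ≠ l → o ≠ h → SwAll ends l h o by
    intro V E _ _ _ _ ends l h o hlh hol hoh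
    exact key _ V E ends rfl l h o hlh hol hoh
  intro n
  induction n using Nat.strong_induction_on with
  | _ n ih =>
    intro V E _ _ _ _ ends hn l h o hlh hol hoh
    -- the induction hypothesis for every placement of the marks
    have ih' : ∀ (E' : Type) [Fintype E'] [DecidableEq E'] (ends' : E' → Sym2 V),
        Fintype.card E' < n → ∀ l h o : V, SwAll ends' l h o := by
      intro E' _ _ ends' hlt l h o
      exact swAll_all_marks (ih _ hlt V E' ends' rfl) l h o
    by_cases hcut : ∃ (c : V) (V₁ V₂ : Set V), HasCut ends c V₁ V₂
    · -- a cut vertex: the block reduction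
      obtain ⟨c, V₁, V₂, hc⟩ := hcut
      have h₁ : Fintype.card (sideE₁ ends V₁) < n := by
        rw [← hn]
        obtain ⟨e, he⟩ := hc.edge₂
        exact Fintype.card_subtype_lt (x := e) he
      have h₂ : Fintype.card (sideE₂ ends V₁) < n := by
        rw [← hn]
        obtain ⟨e, he⟩ := hc.edge₁
        have he' : ∀ x ∈ ends e, x ∈ V₁ := by
          rcases hc.side e with h | h
          · exact h
          · exact absurd h he
        exact Fintype.card_subtype_lt (x := e) (not_not.2 he')
      have hs₁ : ∀ l h o : V, l ≠ h → o ≠ l → o ≠ h → SwAll (ends₁ ends V₁) l h o :=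
        fun l h o _ _ _ => ih' _ (ends₁ ends V₁) h₁ l h o
      have hs₂ : ∀ l h o : V, l ≠ h → o ≠ l → o ≠ h → SwAll (ends₂ ends V₁) l h o :=
        fun l h o _ _ _ => ih' _ (ends₂ ends V₁) h₂ l h o
      have hglue := swAll_glue_of_sides hc.isGluing hs₁ hs₂ hlh hol hoh (hc.cover l) (hc.cover h)
        (hc.cover o)
      rw [glue_sides_eq] at hglue
      exact swAll_of_equiv ends _ hglue
    by_cases hpar : HasParallel ends
    · -- parallel edges: the parallel reduction
      obtain ⟨u, v, e, e', hp⟩ := hpar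
      have hdel : Fintype.card (Parallel.DelE e') < n := by rw [← hn]; exact card_delE_lt e'
      have hmer : Fintype.card (Parallel.MergeE e e') < n := by
        rw [← hn]; have := card_mergeE_add_two_le hp.ne; omega
      exact Parallel.swAll_parallel hp (ih' _ _ hdel l h o) (ih' _ _ hmer _ _ _)
    by_cases hdeg : HasDeg2 ends l h o
    · -- a non-mark vertex of degree two: the series reduction
      obtain ⟨w, u, v, e₁, e₂, hd, hwl, hwh, hwo⟩ := hdeg
      have hdel : Fintype.card (Series.DelE e₁ e₂) < n := by
        rw [← hn]; have := card_seriesDelE_add_two_le hd.ne; omega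
      have hcon : Fintype.card (Series.DelE e₁ e₂ ⊕ Unit) < n := by
        rw [← hn, Fintype.card_sum, Fintype.card_unit]
        have := card_seriesDelE_add_two_le hd.ne; omega
      exact Series.swAll_series hd (Ne.symm hwl) (Ne.symm hwh) (Ne.symm hwo)
        (ih' _ _ hdel l h o) (ih' _ _ hcon l h o)
    · exact hres V E ends hcut hpar l h o hlh hol hoh hdeg

/-- **The weight-free base through the residual class**: row (SW) on every finite multigraph follows
from the rigid row on the residual class. -/
theorem sw_all_of_residual (hres : SwAllResidual) : Sw_all :=
  sw_all_of_swAll_all (swAll_all_of_residual hres)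

end Glue

end Summit.Ventures.PercRepro2
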